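import Summits.CriticalPhenomena.PercolationContinuityZ3.Theorems.PercNearOneGluingNoHeavyLowerTailThreePointPiecesStars
import Summits.CriticalPhenomena.PercolationContinuityZ3.Theorems.PercNearOneGluingNoHeavyLowerTailThreePointPlusHubGraphs
import HarnessLib

/-!
# THEOREM P⁺: the sharpened three-point row `(3PT+)` for parallel compositions of star-shaped and series pieces

Support file for crux `stmt-CriticalPhenomena-4575` (`NoHeavyLowerTail`), lane `prim-facecert` gen 18
(`--supports stmt-CriticalPhenomena-4575`).  Memo `run/shared/lean/prim/prim-l12/prim-facecert/FINDING-gen18-HUB-STEP-CERTIFICATE.md`.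

prim-l12-p1 gen 20 (`…ThreePointPieces*`: THEOREM P) proved the variance row `(3PT)` for every parallel composition, at the terminals
`a, b, c`, of STAR-SHAPED pieces (a centre joined to `a, b, c` by three arbitrary two-terminal ray networks) and SERIES pieces (one
terminal separates the other two inside the piece), via the isolation criterion `(K)`.  THIS FILE upgrades THEOREM P to the sharpened row

  `(3PT+)   P(abc)·P(¬abc) ≤ P(ac|b) + P(bc|a) + 2·P(abc)·P(ab|c)`

on the same class (`threePointPlus_of_stars_and_series`), which `(K)` alone does not give.  The point [this work]: every such piece is a
HUB LAW — its four cylinder probabilities `(Qᵢ, Aᵢ, Bᵢ, Cᵢ)` are the single-hub expressions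
`(1−αβ−αγ−βγ+2αβγ, 1−γ(α+β−αβ), 1−β(α+γ−αγ), 1−α(β+γ−βγ))` for some `(α,β,γ) ∈ [0,1]³`: a star piece with its three ray
probabilities (`real_starPiece`), a series piece with middle `c` as the degenerate hub `(1−Cᵢ, 1−Bᵢ, 1)` (`real_series`: `Aᵢ = Qᵢ = CᵢBᵢ`),
middle `a` as `(1, 1−Bᵢ, 1−Aᵢ)`, middle `b` as `(1−Cᵢ, 1, 1−Aᵢ)`.  Hence the whole law is a product of hub factors and terminal-edge factors
and `ThreePointPlusIsoProduct.threePointPlus_hubTriLaw` (the hub-step certificate of gen 18) applies; the cell bookkeeping is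
`ThreePointPlusHubGraphs.threePointPlus_of_isoIneq`.  `threePointPlus_of_hubLawPieces` is the generic statement (any labelling whose pieces
are hub laws).  Not here: pieces that are not hub laws (two-hub pieces violate `(K)`, memo of p1 gen 20 §1), general graphs (row false).
-/

namespace Summit.CriticalPhenomena.PercolationContinuityZ3.Theorems.ThreePointPlusPieces

open MeasureTheory Set
open Literature.Probability.Percolation Literature.Probability.LatticeModels
open Summit.CriticalPhenomena.PercolationContinuityZ3.Theorems.ThreePointHubEvents (tClosed real_tClosed real_tClosed_inter)
open Summit.CriticalPhenomena.PercolationContinuityZ3.Theorems.ThreePointPieces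

variable {V : Type*} [Fintype V] [DecidableEq V] {ι : Type*} [Fintype ι] [DecidableEq ι]

/-- **`(3PT+)` for parallel compositions of hub-law pieces.**  Let `part : V → ι` label the vertices so that non-terminals with
different labels are never joined.  If for every piece `i` the cylinder probabilities `Qᵢ = P(a|b|c inside i)`, `Aᵢ = P(c isolated
inside i)`, `Bᵢ = P(b isolated inside i)`, `Cᵢ = P(a isolated inside i)` are the single-hub expressions of some `(α, β, γ) ∈ [0,1]³`, then
`P(abc)·P(¬abc) ≤ P(ac|b) + P(bc|a) + 2·P(abc)·P(ab|c)`. [this work] -/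
theorem threePointPlus_of_hubLawPieces (w : Sym2 V → unitInterval) {a b c : V} (hab : a ≠ b) (hac : a ≠ c) (hbc : b ≠ c)
    (part : V → ι) (hw : ∀ u v : V, u ∉ terms a b c → v ∉ terms a b c → part u ≠ part v → (w s(u, v) : ℝ) = 0)
    (hhub : ∀ i, ∃ α β γ : ℝ, 0 ≤ α ∧ α ≤ 1 ∧ 0 ≤ β ∧ β ≤ 1 ∧ 0 ≤ γ ∧ γ ≤ 1 ∧
      (prodBernoulli w).real (isoPiece (piecePairs a b c part i) a b c ∩ isoPiece (piecePairs a b c part i) b a c) =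
          1 - α * β - α * γ - β * γ + 2 * α * β * γ ∧
        (prodBernoulli w).real (isoPiece (piecePairs a b c part i) c a b) = 1 - γ * (α + β - α * β) ∧
        (prodBernoulli w).real (isoPiece (piecePairs a b c part i) b a c) = 1 - β * (α + γ - α * γ) ∧
        (prodBernoulli w).real (isoPiece (piecePairs a b c part i) a b c) = 1 - α * (β + γ - β * γ)) :
    (prodBernoulli w).real (openConn a b ∩ openConn a c) * (prodBernoulli w).real (openConn a b ∩ openConn a c)ᶜ ≤
      (prodBernoulli w).real (openConn a c ∩ (openConn a b)ᶜ) + (prodBernoulli w).real (openConn b c ∩ (openConn a b)ᶜ) +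
        2 * (prodBernoulli w).real (openConn a b ∩ openConn a c) *
          (prodBernoulli w).real (openConn a b ∩ (openConn a c)ᶜ) := by
  have hN : (prodBernoulli w).real (badP a b c part) = 0 := real_badP w a b c part hw
  choose α β γ hα hα1 hβ hβ1 hγ hγ1 eQi eAi eBi eCi using hhub
  refine ThreePointPlusHubGraphs.threePointPlus_of_isoIneq w a b c ?_
  set μ := prodBernoulli w with hμ
  set F : ι → Finset (Sym2 V) := fun i => piecePairs a b c part i with hF
  set pab : ℝ := (w s(a, b) : ℝ)
  set pac : ℝ := (w s(a, c) : ℝ)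
  set pbc : ℝ := (w s(b, c) : ℝ)
  -- the four isolation probabilities as products of hub factors
  have eQ : μ.real (((openConn a b)ᶜ ∩ (openConn a c)ᶜ) ∩ ((openConn a b)ᶜ ∩ (openConn b c)ᶜ)) =
      (1 - pab) * (1 - pac) * (1 - pbc) *
        ∏ i ∈ (Finset.univ : Finset ι), (1 - α i * β i - α i * γ i - β i * γ i + 2 * α i * β i * γ i) := by
    rw [hμ, real_sepP' w part hab hac hbc hN, real_sepP, real_tClosed_inter w hab hac hbc]
    congr 1
    exact Finset.prod_congr rfl fun i _ => eQi i
  have eA : μ.real ((openConn a c)ᶜ ∩ (openConn b c)ᶜ) =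
      (1 - pac) * (1 - pbc) * ∏ i ∈ (Finset.univ : Finset ι), (1 - γ i * (α i + β i - α i * β i)) := by
    rw [hμ, real_isoPc w part hac hbc hN, real_isoP w a b c part (mem_terms.2 (Or.inr (Or.inr rfl))) (mem_terms.2 (Or.inl rfl))
      (mem_terms.2 (Or.inr (Or.inl rfl))), real_tClosed w hab, Sym2.eq_swap (a := c) (b := a), Sym2.eq_swap (a := c) (b := b)]
    congr 1
    exact Finset.prod_congr rfl fun i _ => eAi i
  have eB : μ.real ((openConn a b)ᶜ ∩ (openConn b c)ᶜ) =
      (1 - pab) * (1 - pbc) * ∏ i ∈ (Finset.univ : Finset ι), (1 - β i * (α i + γ i - α i * γ i)) := by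
    rw [hμ, real_isoPb w part hab hbc hN, real_isoP w a b c part (mem_terms.2 (Or.inr (Or.inl rfl))) (mem_terms.2 (Or.inl rfl))
      (mem_terms.2 (Or.inr (Or.inr rfl))), real_tClosed w hac, Sym2.eq_swap (a := b) (b := a)]
    congr 1
    exact Finset.prod_congr rfl fun i _ => eBi i
  have eC : μ.real ((openConn a b)ᶜ ∩ (openConn a c)ᶜ) =
      (1 - pab) * (1 - pac) * ∏ i ∈ (Finset.univ : Finset ι), (1 - α i * (β i + γ i - β i * γ i)) := by
    rw [hμ, real_isoPa w part hab hac hN, real_isoP w a b c part (mem_terms.2 (Or.inl rfl)) (mem_terms.2 (Or.inr (Or.inl rfl)))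
      (mem_terms.2 (Or.inr (Or.inr rfl))), real_tClosed w hbc]
    congr 1
    exact Finset.prod_congr rfl fun i _ => eCi i
  have h01 : ∀ i ∈ (Finset.univ : Finset ι), 0 ≤ α i ∧ α i ≤ 1 ∧ 0 ≤ β i ∧ β i ≤ 1 ∧ 0 ≤ γ i ∧ γ i ≤ 1 :=
    fun i _ => ⟨hα i, hα1 i, hβ i, hβ1 i, hγ i, hγ1 i⟩
  have h := ThreePointPlusIsoProduct.threePointPlus_hubTriLaw (Finset.univ : Finset ι) α β γ (pab := pab) (pac := pac)
    (pbc := pbc) (unitInterval.nonneg (w s(a, b))) (unitInterval.le_one (w s(a, b))) (unitInterval.nonneg (w s(a, c)))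
    (unitInterval.le_one (w s(a, c))) (unitInterval.nonneg (w s(b, c))) (unitInterval.le_one (w s(b, c))) h01
  simp only at h
  rw [eQ, eA, eB, eC]
  nlinarith [h]

/-- **THEOREM P⁺ — `(3PT+)` for every parallel composition of star-shaped pieces and series pieces, all weights.**
Hypotheses exactly as in `ThreePointPieces.threePointVariance_of_stars_and_series` (THEOREM P): `part : V → ι` labels the vertices,
non-terminals with different labels are never joined, and every piece is EITHER star-shaped (a non-terminal centre `h` and a ray
labelling `ρ`: every piece pair avoiding `h` lies inside one ray) OR a series piece (a side `X` separating, for one choice of the middle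
terminal, `{x} ∪ X` from `{y} ∪ rest`).  Conclusion: `P(abc)·P(¬abc) ≤ P(ac|b) + P(bc|a) + 2·P(abc)·P(ab|c)`.  Contains THEOREM H⁺
(`ThreePointPlusHubGraphs.threePointPlus_hubGraph`: every piece a single hub = a star with empty rays). [this work] -/
theorem threePointPlus_of_stars_and_series (w : Sym2 V → unitInterval) {a b c : V} (hab : a ≠ b) (hac : a ≠ c)
    (hbc : b ≠ c) (part : V → ι) (hw : ∀ u v : V, u ∉ terms a b c → v ∉ terms a b c → part u ≠ part v → (w s(u, v) : ℝ) = 0)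
    (hkind : ∀ i, (∃ (h : V) (ρ : V → V), h ∉ terms a b c ∧ part h = i ∧
        ∀ u v : V, s(u, v) ∈ piecePairs a b c part i → u ≠ h → v ≠ h →
          (¬ ∃ x, x ∈ terms a b c ∧ (u = x ∨ (u ∉ terms a b c ∧ part u = i ∧ ρ u = x)) ∧
            (v = x ∨ (v ∉ terms a b c ∧ part v = i ∧ ρ v = x))) → (w s(u, v) : ℝ) = 0) ∨
      ∃ X : Finset V,
        (∀ u v : V, (u = a ∨ (u ∉ terms a b c ∧ part u = i ∧ u ∈ X)) → (v = b ∨ (v ∉ terms a b c ∧ part v = i ∧ v ∉ X)) →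
          ((u ∉ terms a b c ∧ part u = i ∧ u ∈ X) ∨ (v ∉ terms a b c ∧ part v = i ∧ v ∉ X)) → (w s(u, v) : ℝ) = 0) ∨
        (∀ u v : V, (u = b ∨ (u ∉ terms a b c ∧ part u = i ∧ u ∈ X)) → (v = c ∨ (v ∉ terms a b c ∧ part v = i ∧ v ∉ X)) →
          ((u ∉ terms a b c ∧ part u = i ∧ u ∈ X) ∨ (v ∉ terms a b c ∧ part v = i ∧ v ∉ X)) → (w s(u, v) : ℝ) = 0) ∨
        (∀ u v : V, (u = a ∨ (u ∉ terms a b c ∧ part u = i ∧ u ∈ X)) → (v = c ∨ (v ∉ terms a b c ∧ part v = i ∧ v ∉ X)) →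
          ((u ∉ terms a b c ∧ part u = i ∧ u ∈ X) ∨ (v ∉ terms a b c ∧ part v = i ∧ v ∉ X)) → (w s(u, v) : ℝ) = 0)) :
    (prodBernoulli w).real (openConn a b ∩ openConn a c) * (prodBernoulli w).real (openConn a b ∩ openConn a c)ᶜ ≤
      (prodBernoulli w).real (openConn a c ∩ (openConn a b)ᶜ) + (prodBernoulli w).real (openConn b c ∩ (openConn a b)ᶜ) +
        2 * (prodBernoulli w).real (openConn a b ∩ openConn a c) *
          (prodBernoulli w).real (openConn a b ∩ (openConn a c)ᶜ) := by
  refine threePointPlus_of_hubLawPieces w hab hac hbc part hw fun i => ?_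
  set F := piecePairs a b c part i with hF
  have ha : a ∈ terms a b c := mem_terms.2 (Or.inl rfl)
  have hb : b ∈ terms a b c := mem_terms.2 (Or.inr (Or.inl rfl))
  have hc : c ∈ terms a b c := mem_terms.2 (Or.inr (Or.inr rfl))
  -- the three piece isolation probabilities are in `[0,1]`
  have hC0 : 0 ≤ (prodBernoulli w).real (isoPiece F a b c) := measureReal_nonneg
  have hC1 : (prodBernoulli w).real (isoPiece F a b c) ≤ 1 := measureReal_le_one
  have hB0 : 0 ≤ (prodBernoulli w).real (isoPiece F b a c) := measureReal_nonneg
  have hB1 : (prodBernoulli w).real (isoPiece F b a c) ≤ 1 := measureReal_le_one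
  have hA0 : 0 ≤ (prodBernoulli w).real (isoPiece F c a b) := measureReal_nonneg
  have hA1 : (prodBernoulli w).real (isoPiece F c a b) ≤ 1 := measureReal_le_one
  rcases hkind i with ⟨h, ρ, hh, hhi, hs⟩ | ⟨X, hX⟩
  · -- star-shaped piece: the hub law of the three ray probabilities
    obtain ⟨rC, rB, rA, rQ⟩ := real_starPiece w (part := part) (i := i) (h := h) (ρ := ρ) hab hac hbc hh hhi hs
    refine ⟨(prodBernoulli w).real (rayConn a b c part i h ρ a), (prodBernoulli w).real (rayConn a b c part i h ρ b),
      (prodBernoulli w).real (rayConn a b c part i h ρ c), measureReal_nonneg, measureReal_le_one, measureReal_nonneg,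
      measureReal_le_one, measureReal_nonneg, measureReal_le_one, rQ, ?_, ?_, ?_⟩
    · rw [rA]; ring
    · rw [rB]; ring
    · rw [rC]; ring
  · rcases hX with hX | hX | hX
    · -- series piece, middle `c`: the degenerate hub `(1 − Cᵢ, 1 − Bᵢ, 1)`
      have hT : ∀ v, v ∈ terms a b c → v = a ∨ v = b ∨ v = c := fun v hv => mem_terms.1 hv
      obtain ⟨h1, h2⟩ := real_series w (part := part) (i := i) (X := X) hT ha hb hc hab hac hbc hX
      refine ⟨1 - (prodBernoulli w).real (isoPiece F a b c), 1 - (prodBernoulli w).real (isoPiece F b a c), 1,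
        by linarith, by linarith, by linarith, by linarith, zero_le_one, le_rfl, ?_, ?_, ?_, ?_⟩
      · rw [h2]; ring
      · rw [h1, h2]; ring
      · ring
      · ring
    · -- series piece, middle `a`: the degenerate hub `(1, 1 − Bᵢ, 1 − Aᵢ)`
      have hT : ∀ v, v ∈ terms a b c → v = b ∨ v = c ∨ v = a := fun v hv => by rw [mem_terms] at hv; tauto
      obtain ⟨h1, h2⟩ := real_series w (part := part) (i := i) (X := X) hT hb hc ha hbc (Ne.symm hab) (Ne.symm hac) hX
      have e1 : isoPiece F b c a = isoPiece F b a c := isoPiece_swap F b c a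
      have e2 : isoPiece F c b a = isoPiece F c a b := isoPiece_swap F c b a
      rw [e1, e2, isoPiece_inter_eq F a b c] at h1 h2
      refine ⟨1, 1 - (prodBernoulli w).real (isoPiece F b a c), 1 - (prodBernoulli w).real (isoPiece F c a b),
        zero_le_one, le_rfl, by linarith, by linarith, by linarith, by linarith, ?_, ?_, ?_, ?_⟩
      · rw [h2]; ring
      · ring
      · ring
      · rw [h1, h2]; ring
    · -- series piece, middle `b`: the degenerate hub `(1 − Cᵢ, 1, 1 − Aᵢ)`
      have hT : ∀ v, v ∈ terms a b c → v = a ∨ v = c ∨ v = b := fun v hv => by rw [mem_terms] at hv; tauto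
      obtain ⟨h1, h2⟩ := real_series w (part := part) (i := i) (X := X) hT ha hc hb hac hab (Ne.symm hbc) hX
      have e1 : isoPiece F a c b = isoPiece F a b c := isoPiece_swap F a c b
      have e2 : isoPiece F c a b ∩ isoPiece F a b c = isoPiece F a b c ∩ isoPiece F b a c := by
        rw [Set.inter_comm]
        have h' := isoPiece_inter_eq F b a c
        rw [isoPiece_swap F c b a] at h'
        rw [h', Set.inter_comm]
      rw [e1] at h1 h2
      rw [Set.inter_comm, e2] at h1 h2
      refine ⟨1 - (prodBernoulli w).real (isoPiece F a b c), 1, 1 - (prodBernoulli w).real (isoPiece F c a b),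
        by linarith, by linarith, zero_le_one, le_rfl, by linarith, by linarith, ?_, ?_, ?_, ?_⟩
      · rw [h2]; ring
      · ring
      · rw [h1, h2]; ring
      · ring

end Summit.CriticalPhenomena.PercolationContinuityZ3.Theorems.ThreePointPlusPieces
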